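import Summits.Ventures.PercRepro.ProfilePointedMinimalWitness

/-!
# PercRepro — (Ĉ) AT A UNIFORM `U_{r,2r}`-RESTRICTION: THE PROFILE SPLITS OFF THE RESTRICTION, (Ĉ) HOLDS AT EVERY
POINT OF IT, AND (Ĉ) ELSEWHERE REDUCES TO A MINOR ON `2r` FEWER ELEMENTS (p10, gen 24; modulo Theorem A = the named fact)

A finset `L ⊆ E` with `#L = 2r`, `ρ(L) = r` and every `r`-subset independent (the restriction `N|L` is `U_{r,2r}`) is a
UNIFORM restriction of `N` when the independence of `X ∪ T`, for `X ⊆ E ∖ L` and an `r`-subset `T ⊆ L`, does not depend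
on `T` (`UniformRestriction`).  For `r = 1` this is a parallel pair; for `r = 2` a 4-point line such that
`X ∪ {l, l'}` is independent for one pair `{l, l'} ⊆ L` iff for every pair — e.g. the 4-point line of a 2-sum
`M ⊕₂ U_{2,5}` and the line through the basepoint of a parallel connection `P(M, U_{2,4})`, the two classes of the
residue of (Ĉ) on ≤ 9 elements after the reductions of gens 13–23.

THE SPLIT (unconditional).  A bi-independent set meets `L` in exactly `r` elements (`card_inter_eq_of_mem_biIndepSets`:
both `X ∩ L` and `(E ∖ X) ∩ L` are independent subsets of the rank-`r` set `L`, and they partition `L`), and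
`X ↦ (X ∩ L, X ∖ L)` is a bijection from `BI_k(N)` onto `(r-subsets of L) × BI_{k−r}(N′)`, where `N′ = N / T ∖ (L ∖ T)`
for ANY `r`-subset `T` of `L` (`mem_biIndepSets_uniform_iff`: by uniformity, `X` is independent iff `(X ∖ L) ∪ T` is,
and likewise for the complement):  `P_k(N) = C(2r, r) · P_{k−r}(N′)` (`card_biIndepSets_uniform`), `P_k(N) = 0` for
`k < r`.  The same bijection carries the `p`-extendable sets: `c^p_k(N) = C(2r, r) · c^p_{k−r}(N′)` for `p ∉ L`
(`extCount_uniform`), and `c^p_k(N) = 0` for `p ∈ L` (`extCount_uniform_of_mem`: `X ∪ p` would meet `L` in `r + 1`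
elements).

THE ARITHMETIC is in ProfilePointedUniformRestrictionRow: with `#E = m + 2r` and `k = j + r`, (Ĉ) at `(N, p, k)` is
`C(2r,r)` times [(Ĉ) at `(N′, p, j)` plus `r` copies of Theorem A's `P_j ≤ P_{j+1}` on `N′`] for `p ∉ L`, and
`C(2r,r)` times [Theorem A's `(m − j)·P_j ≤ (j+1)·P_{j+1}` plus `r − 1` copies of `P_j ≤ P_{j+1}`] for `p ∈ L` — (Ĉ)
holds at every point of a uniform `U_{r,2r}`-restriction with no (Ĉ)-hypothesis, (Ĉ) elsewhere reduces to `N′` on `2r`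
fewer elements, and a minimal (Ĉ)-witness has no uniform `U_{r,2r}`-restriction for any `r ≥ 1` (`r = 1`: the
parallel-pair theorems of gens 13 and 23; `r = 2`: the line points of `M ⊕₂ U_{2,5}` and of `P(M, U_{2,4})`, i.e. the
whole residue of (Ĉ) on ≤ 9 elements after the reductions of gens 13–23).  Also here: `card_gr_contract_delete_sub`
(`#E(N′) = #E − 2r`).  Everything in this file is unconditional.  Nothing here asserts (Ĉ).
-/

open scoped Matroid

namespace PercRepro.Cogirth

open Finset ThmH Skew

variable {α : Type} [DecidableEq α] {N : Matroid α} [N.Finite]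

/-- **A uniform `U_{r,2r}`-restriction** of `N`: `L ⊆ E`, `#L = 2r`, `ρ(L) = r`, every `r`-subset of `L` is
independent, and for `X ⊆ E ∖ L` the independence of `X ∪ T` does not depend on the `r`-subset `T ⊆ L`. -/
structure UniformRestriction (N : Matroid α) [N.Finite] (L : Finset α) (r : ℕ) : Prop where
  subset_gr : L ⊆ gr N
  card_eq : L.card = 2 * r
  rk_eq : rk N L = r
  rk_sub : ∀ T ∈ L.powersetCard r, rk N T = r
  uniform : ∀ X ⊆ gr N \ L, ∀ T ∈ L.powersetCard r, ∀ T' ∈ L.powersetCard r,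
    rk N (X ∪ T) = (X ∪ T).card → rk N (X ∪ T') = (X ∪ T').card

section uniform

variable {L : Finset α} {r : ℕ}

/-- The ground finset of the minor `N / T ∖ (L ∖ T)` is `E ∖ L`. -/
theorem gr_contract_delete_sub {T : Finset α} (hTL : T ⊆ L) :
    gr (N ／ (T : Set α) ＼ ((L \ T : Finset α) : Set α)) = gr N \ L := by
  apply Finset.coe_injective
  rw [coe_gr, Matroid.delete_ground, Matroid.contract_ground, Finset.coe_sdiff, Finset.coe_sdiff, coe_gr,
    Set.sdiff_sdiff, Set.union_sdiff_cancel (Finset.coe_subset.2 hTL)]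

/-- For `Z ⊆ E ∖ L` and an independent `T ⊆ L`: `Z` is independent in `N / T ∖ (L ∖ T)` iff `Z ∪ T` is independent
in `N`. -/
theorem rk_contract_delete_eq_card_iff {T : Finset α} (hTL : T ⊆ L) (hT : rk N T = T.card) {Z : Finset α}
    (hZ : Z ⊆ gr N \ L) :
    rk (N ／ (T : Set α) ＼ ((L \ T : Finset α) : Set α)) Z = Z.card ↔ rk N (Z ∪ T) = (Z ∪ T).card := by
  have hTi : N.Indep (T : Set α) := indep_of_rk_eq_card' hT
  have hZT : Disjoint Z T := disjoint_left.2 (fun x hx hxT => (mem_sdiff.1 (hZ hx)).2 (hTL hxT))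
  have hZD : Disjoint Z (L \ T) := disjoint_left.2 (fun x hx hxD => (mem_sdiff.1 (hZ hx)).2 (mem_sdiff.1 hxD).1)
  constructor
  · intro h
    have h1 := indep_of_rk_eq_card' h
    rw [Matroid.delete_indep_iff, hTi.contract_indep_iff] at h1
    obtain ⟨⟨-, h2⟩, -⟩ := h1
    rw [← Finset.coe_union] at h2
    exact rk_eq_card_of_indep' h2
  · intro h
    apply rk_eq_card_of_indep'
    rw [Matroid.delete_indep_iff, hTi.contract_indep_iff]
    refine ⟨⟨Finset.disjoint_coe.2 hZT, ?_⟩, Finset.disjoint_coe.2 hZD⟩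
    rw [← Finset.coe_union]
    exact indep_of_rk_eq_card' h

/-- The two traces of `X` and of its complement on `L` partition `L`: `#(X ∩ L) + #((E ∖ X) ∩ L) = #L`. -/
theorem card_inter_add_card_sdiff_inter (hL : L ⊆ gr N) (X : Finset α) :
    (X ∩ L).card + ((gr N \ X) ∩ L).card = L.card := by
  rw [← card_union_of_disjoint]
  · congr 1
    ext x
    simp only [mem_union, mem_inter, mem_sdiff]
    constructor
    · rintro (⟨-, hx⟩ | ⟨-, hx⟩) <;> exact hx
    · intro hx
      by_cases hxX : x ∈ X
      · exact Or.inl ⟨hxX, hx⟩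
      · exact Or.inr ⟨⟨hL hx, hxX⟩, hx⟩
  · exact disjoint_left.2 (fun x hx hx' => (mem_sdiff.1 (mem_inter.1 hx').1).2 (mem_inter.1 hx).1)

/-- **A bi-independent set meets a uniform `U_{r,2r}`-restriction in exactly `r` elements.** -/
theorem card_inter_eq_of_mem_biIndepSets (hL : UniformRestriction N L r) {k : ℕ} {X : Finset α}
    (hX : X ∈ biIndepSets N k) : (X ∩ L).card = r := by
  rw [mem_biIndepSets] at hX
  obtain ⟨-, -, hXr, hXc⟩ := hX
  have h1 : (X ∩ L).card ≤ r := by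
    rw [← rk_eq_card_of_subset_of_rk_eq_card inter_subset_left hXr, ← hL.rk_eq]
    exact rk_mono' inter_subset_right
  have h2 : ((gr N \ X) ∩ L).card ≤ r := by
    rw [← rk_eq_card_of_subset_of_rk_eq_card inter_subset_left hXc, ← hL.rk_eq]
    exact rk_mono' inter_subset_right
  have h3 := card_inter_add_card_sdiff_inter hL.subset_gr X
  rw [hL.card_eq] at h3
  omega

/-- The complement trace on `L` has `r` elements as soon as the trace of `X` does. -/
theorem card_sdiff_inter_eq (hL : UniformRestriction N L r) {X : Finset α} (hXL : (X ∩ L).card = r) :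
    ((gr N \ X) ∩ L).card = r := by
  have h3 := card_inter_add_card_sdiff_inter hL.subset_gr X
  rw [hL.card_eq, hXL] at h3
  omega

/-- Uniformity as an equivalence. -/
theorem rk_union_eq_card_iff_uniform (hL : UniformRestriction N L r) {X : Finset α} (hX : X ⊆ gr N \ L)
    {T T' : Finset α} (hT : T ∈ L.powersetCard r) (hT' : T' ∈ L.powersetCard r) :
    rk N (X ∪ T) = (X ∪ T).card ↔ rk N (X ∪ T') = (X ∪ T').card :=
  ⟨hL.uniform X hX T hT T' hT', hL.uniform X hX T' hT' T hT⟩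

/-- **THE BIJECTION**: for `X ⊆ E` meeting `L` in `r` elements and `r ≤ k`, `X` is bi-independent in `N` at level `k`
iff `X ∖ L` is bi-independent in `N / T ∖ (L ∖ T)` at level `k − r` — for any `r`-subset `T` of `L`. -/
theorem mem_biIndepSets_uniform_iff (hL : UniformRestriction N L r) {T : Finset α} (hT : T ∈ L.powersetCard r)
    {k : ℕ} (hk : r ≤ k) {X : Finset α} (hXg : X ⊆ gr N) (hXL : (X ∩ L).card = r) :
    X ∈ biIndepSets N k ↔ X \ L ∈ biIndepSets (N ／ (T : Set α) ＼ ((L \ T : Finset α) : Set α)) (k - r) := by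
  obtain ⟨hTL, hTc⟩ := mem_powersetCard.1 hT
  have hTr : rk N T = T.card := by rw [hTc]; exact hL.rk_sub T hT
  have hXL' : X ∩ L ∈ L.powersetCard r := mem_powersetCard.2 ⟨inter_subset_right, hXL⟩
  have hYL' : (gr N \ X) ∩ L ∈ L.powersetCard r :=
    mem_powersetCard.2 ⟨inter_subset_right, card_sdiff_inter_eq hL hXL⟩
  have hXsub : X \ L ⊆ gr N \ L := sdiff_subset_sdiff hXg (subset_refl L)
  have hYsub : (gr N \ X) \ L ⊆ gr N \ L := sdiff_subset_sdiff sdiff_subset (subset_refl L)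
  have hY : (gr N \ L) \ (X \ L) = (gr N \ X) \ L := by
    ext x
    simp only [mem_sdiff, not_and, not_not]
    constructor
    · rintro ⟨⟨hx, hxL⟩, h⟩
      exact ⟨⟨hx, fun hxX => hxL (h hxX)⟩, hxL⟩
    · rintro ⟨⟨hx, hxX⟩, hxL⟩
      exact ⟨⟨hx, hxL⟩, fun hxX' => absurd hxX' hxX⟩
  have hcard : (X \ L).card + r = X.card := by
    rw [← hXL, card_sdiff_add_card_inter]
  rw [mem_biIndepSets, mem_biIndepSets, gr_contract_delete_sub hTL, hY,
    rk_contract_delete_eq_card_iff hTL hTr hXsub, rk_contract_delete_eq_card_iff hTL hTr hYsub,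
    ← rk_union_eq_card_iff_uniform hL hXsub hXL' hT, ← rk_union_eq_card_iff_uniform hL hYsub hYL' hT,
    sdiff_union_inter, sdiff_union_inter]
  constructor
  · rintro ⟨-, hXk, hXr, hXc⟩
    exact ⟨hXsub, by omega, hXr, hXc⟩
  · rintro ⟨-, hXk, hXr, hXc⟩
    exact ⟨hXg, by omega, hXr, hXc⟩

/-- No bi-independent set below level `r`. -/
theorem card_biIndepSets_uniform_eq_zero_of_lt (hL : UniformRestriction N L r) {k : ℕ} (hk : k < r) :
    (biIndepSets N k).card = 0 := by
  rw [card_eq_zero, eq_empty_iff_forall_notMem]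
  intro X hX
  have h1 := card_inter_eq_of_mem_biIndepSets hL hX
  have h2 : (X ∩ L).card ≤ X.card := card_le_card inter_subset_left
  rw [(mem_biIndepSets.1 hX).2.1] at h2
  omega

/-- **THE PROFILE SPLITS OFF A UNIFORM `U_{r,2r}`-RESTRICTION** (unconditional): for `r ≤ k` and any `r`-subset `T`
of `L`, `P_k(N) = C(2r, r) · P_{k−r}(N / T ∖ (L ∖ T))`. -/
theorem card_biIndepSets_uniform (hL : UniformRestriction N L r) {T : Finset α} (hT : T ∈ L.powersetCard r)
    {k : ℕ} (hk : r ≤ k) :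
    (biIndepSets N k).card =
      (2 * r).choose r * (biIndepSets (N ／ (T : Set α) ＼ ((L \ T : Finset α) : Set α)) (k - r)).card := by
  rw [← hL.card_eq, ← card_powersetCard, ← card_product]
  apply card_bij (fun X _ => (X ∩ L, X \ L))
  · intro X hX
    rw [mem_product]
    refine ⟨mem_powersetCard.2 ⟨inter_subset_right, card_inter_eq_of_mem_biIndepSets hL hX⟩, ?_⟩
    exact (mem_biIndepSets_uniform_iff hL hT hk (mem_biIndepSets.1 hX).1
      (card_inter_eq_of_mem_biIndepSets hL hX)).1 hX
  · intro X hX Y hY h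
    simp only [Prod.mk.injEq] at h
    rw [← sdiff_union_inter X L, ← sdiff_union_inter Y L, h.1, h.2]
  · rintro ⟨T', Z⟩ hTZ
    rw [mem_product] at hTZ
    obtain ⟨hT', hZ⟩ := hTZ
    obtain ⟨hT'L, hT'c⟩ := mem_powersetCard.1 hT'
    have hZg : Z ⊆ gr N \ L := by
      have := (mem_biIndepSets.1 hZ).1
      rwa [gr_contract_delete_sub (mem_powersetCard.1 hT).1] at this
    have hZL : Z ∩ L = ∅ := by
      rw [eq_empty_iff_forall_notMem]
      intro x hx
      exact (mem_sdiff.1 (hZg (mem_inter.1 hx).1)).2 (mem_inter.1 hx).2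
    have e1 : (Z ∪ T') ∩ L = T' := by
      rw [union_inter_distrib_right, hZL, empty_union, inter_eq_left.2 hT'L]
    have e2 : (Z ∪ T') \ L = Z := by
      ext x
      simp only [mem_sdiff, mem_union]
      constructor
      · rintro ⟨hx | hx, hxL⟩
        · exact hx
        · exact absurd (hT'L hx) hxL
      · intro hx
        exact ⟨Or.inl hx, (mem_sdiff.1 (hZg hx)).2⟩
    refine ⟨Z ∪ T', ?_, by rw [e1, e2]⟩
    have hXg : Z ∪ T' ⊆ gr N :=
      union_subset (hZg.trans sdiff_subset) (hT'L.trans hL.subset_gr)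
    rw [mem_biIndepSets_uniform_iff hL hT hk hXg (by rw [e1, hT'c]), e2]
    exact hZ

/-- **No bi-independent set extends by a point of a uniform `U_{r,2r}`-restriction**: `c^p_k(N) = 0` for `p ∈ L`. -/
theorem extCount_uniform_of_mem (hL : UniformRestriction N L r) {p : α} (hp : p ∈ L) (k : ℕ) :
    extCount N k p = 0 := by
  unfold extCount
  rw [card_eq_zero, filter_eq_empty_iff]
  intro X hX
  rintro ⟨hpX, hins⟩
  have h1 := card_inter_eq_of_mem_biIndepSets hL hX
  have h2 := card_inter_eq_of_mem_biIndepSets hL hins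
  rw [insert_inter_of_mem hp, card_insert_of_notMem (fun h => hpX (mem_inter.1 h).1), h1] at h2
  omega

/-- **The `p`-extendable sets split off the restriction**: for `p ∈ E ∖ L` and `r ≤ k`,
`c^p_k(N) = C(2r, r) · c^p_{k−r}(N / T ∖ (L ∖ T))`. -/
theorem extCount_uniform (hL : UniformRestriction N L r) {T : Finset α} (hT : T ∈ L.powersetCard r) {p : α}
    (hp : p ∈ gr N) (hpL : p ∉ L) {k : ℕ} (hk : r ≤ k) :
    extCount N k p =
      (2 * r).choose r * extCount (N ／ (T : Set α) ＼ ((L \ T : Finset α) : Set α)) (k - r) p := by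
  unfold extCount
  rw [← hL.card_eq, ← card_powersetCard, ← card_product]
  apply card_bij (fun X _ => (X ∩ L, X \ L))
  · intro X hX
    rw [mem_filter] at hX
    obtain ⟨hX, hpX, hins⟩ := hX
    rw [mem_product, mem_filter]
    refine ⟨mem_powersetCard.2 ⟨inter_subset_right, card_inter_eq_of_mem_biIndepSets hL hX⟩, ?_, ?_, ?_⟩
    · exact (mem_biIndepSets_uniform_iff hL hT hk (mem_biIndepSets.1 hX).1
        (card_inter_eq_of_mem_biIndepSets hL hX)).1 hX
    · exact fun h => hpX (mem_sdiff.1 h).1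
    · rw [← insert_sdiff_of_notMem X hpL, show k - r + 1 = k + 1 - r by omega]
      exact (mem_biIndepSets_uniform_iff hL hT (by omega) (mem_biIndepSets.1 hins).1
        (card_inter_eq_of_mem_biIndepSets hL hins)).1 hins
  · intro X hX Y hY h
    simp only [Prod.mk.injEq] at h
    rw [← sdiff_union_inter X L, ← sdiff_union_inter Y L, h.1, h.2]
  · rintro ⟨T', Z⟩ hTZ
    rw [mem_product, mem_filter] at hTZ
    obtain ⟨hT', hZ, hpZ, hinsZ⟩ := hTZ
    obtain ⟨hT'L, hT'c⟩ := mem_powersetCard.1 hT'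
    have hZg : Z ⊆ gr N \ L := by
      have := (mem_biIndepSets.1 hZ).1
      rwa [gr_contract_delete_sub (mem_powersetCard.1 hT).1] at this
    have hZL : Z ∩ L = ∅ := by
      rw [eq_empty_iff_forall_notMem]
      intro x hx
      exact (mem_sdiff.1 (hZg (mem_inter.1 hx).1)).2 (mem_inter.1 hx).2
    have e1 : (Z ∪ T') ∩ L = T' := by
      rw [union_inter_distrib_right, hZL, empty_union, inter_eq_left.2 hT'L]
    have e2 : (Z ∪ T') \ L = Z := by
      ext x
      simp only [mem_sdiff, mem_union]
      constructor
      · rintro ⟨hx | hx, hxL⟩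
        · exact hx
        · exact absurd (hT'L hx) hxL
      · intro hx
        exact ⟨Or.inl hx, (mem_sdiff.1 (hZg hx)).2⟩
    have hXg : Z ∪ T' ⊆ gr N :=
      union_subset (hZg.trans sdiff_subset) (hT'L.trans hL.subset_gr)
    have hpX : p ∉ Z ∪ T' := fun h => (mem_union.1 h).elim hpZ (fun h' => hpL (hT'L h'))
    refine ⟨Z ∪ T', ?_, by rw [e1, e2]⟩
    rw [mem_filter]
    refine ⟨?_, hpX, ?_⟩
    · rw [mem_biIndepSets_uniform_iff hL hT hk hXg (by rw [e1, hT'c]), e2]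
      exact hZ
    · have e3 : insert p (Z ∪ T') ∩ L = T' := by rw [insert_inter_of_notMem hpL, e1]
      rw [mem_biIndepSets_uniform_iff hL hT (by omega) (insert_subset hp hXg) (by rw [e3, hT'c]),
        insert_sdiff_of_notMem _ hpL, e2, show k + 1 - r = k - r + 1 by omega]
      exact hinsZ

/-- The number of elements of the minor: `#E(N / T ∖ (L ∖ T)) = #E − 2r`. -/
theorem card_gr_contract_delete_sub (hL : UniformRestriction N L r) {T : Finset α} (hTL : T ⊆ L) :
    (gr (N ／ (T : Set α) ＼ ((L \ T : Finset α) : Set α))).card = (gr N).card - 2 * r := by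
  rw [gr_contract_delete_sub hTL, card_sdiff_of_subset hL.subset_gr, hL.card_eq]

end uniform

end PercRepro.Cogirth
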